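import Mathlib
import Literature.Computability.AlgebraicComplexity.HessianAtOrigin
import Summits.ValiantsHypothesis.ValiantsHypothesis.Theorems.GrenetZeonTwoDimCoefficientsScalingRayNodes

/-!
# Crux `GrenetZeon.TwoDimCoefficients` (stmt-ValiantsHypothesis-8062), stub `stub_dualUnipotent`:
# scaling-closure — ASSEMBLY of the factor programme (brick L4, conditional on factor data)

The factor programme (memo SEVENTEENTH-HAND.md) bounds `rank Hess per_n` at a generic point `z` through the
irreducible factors `G_o = c_o + Σ_{e ∈ E_o} Ψ_{o,e}` (sums of forms) of the μ_n-orbit products of the scaling-closure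
shadow: (L1/L1′) at the zeros of `G_o` on the ray `t ↦ t·z` the Hessian of `G_o` has rank `≤ ρ = 2m + 2`
(Mignon–Ressayre passed to factors; simple factors ✓ `rank_hess0_factor_le_of_dualUnipotent`, multiple factors = the
open analytic lemma L1′); (L2) `Hess per_n(z)` is a combination of the `Hess Ψ_{o,e}(z)` plus, per orbit, a Gram
remainder of rank `≤ #E_o`, with degree budget `n·Σ_o #E_o ≤ m`; (L3) ray interpolation ✓ `rank_sum_smul_hess0_le_of_rayZeros`.
This file is the kernel-checked endgame taking (L1′)+(L2) as DATA:

* ★ `sq_le_of_factorData` — `n² = rank Hess per_n(z) ≤ Σ_o (#E_o·ρ + r_o)`;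
* ★ `cube_le_of_factorData` — with `r_o ≤ #E_o` and the budget `n·Σ_o #E_o ≤ m`: `n³ ≤ m·(ρ + 1)`; for `ρ = 2m + 2`
  this is the 3/2 rung `n³ ≤ m(2m + 3)` (crux `DualUnipotentThreeHalves`, stmt-24318) on the class of representations
  for which the data exist (hdeg + SQF pencils, conditionally on L1′).

HONEST FRAMING: bookkeeping; the inputs (L1′, L2) are NOT proved here; the stub `DualUnipotentBound`, both cruxes and
`VP ≠ VNP` remain open.

References: folklore.
-/

-- single-conjunct layout `Summits/ValiantsHypothesis/ValiantsHypothesis`: the duplicated namespace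
-- component is mandated by the tree.
set_option linter.dupNamespace false
set_option autoImplicit false

noncomputable section

namespace Summit.ValiantsHypothesis.ValiantsHypothesis.Theorems.GrenetZeonTwoDimCoefficients.ScalingClosure

open MvPolynomial Matrix
open Literature.Computability.AlgebraicComplexity

variable {σ : Type*} [Fintype σ] [DecidableEq σ]

/-- ★ **Assembly of the factor programme (rank form).**  Factor data at a point `z`: finitely many "factors"
`G_o = c_o + Σ_{e ∈ E_o} Ψ_{o,e}` (forms `Ψ_{o,e}` of pairwise distinct degrees `d_{o,e} ≥ 2`), for each `o` distinct ray
parameters `t_{o,1..g_o}` (`g_o > d_{o,e} − 2`) at which `rank Hess G_o(t·z) ≤ ρ`, and a decomposition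
`Hess f(z) = Σ_o (Σ_e a_{o,e} Hess Ψ_{o,e}(z) + R_o)` with `rank R_o ≤ r_o`.  Then `rank Hess f(z) ≤ Σ_o (#E_o·ρ + r_o)`.
[folklore] -/
theorem rank_hess0_le_of_factorData {O : Type*} [Fintype O] (E : O → Type*) [∀ o, Fintype (E o)]
    [∀ o, DecidableEq (E o)] (c : O → ℂ) (Ψ : ∀ o, E o → MvPolynomial σ ℂ) (d : ∀ o, E o → ℕ)
    (hΨ : ∀ o e, (Ψ o e).IsHomogeneous (d o e)) (hd2 : ∀ o e, 2 ≤ d o e)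
    (hd : ∀ o, Function.Injective (d o)) (z : σ → ℂ) (g : O → ℕ) (t : ∀ o, Fin (g o) → ℂ)
    (ht : ∀ o, Function.Injective (t o)) (hg : ∀ o e, d o e - 2 < g o) (ρ : ℕ)
    (hnodes : ∀ o i, (hess0 (transl (t o i • z) (MvPolynomial.C (c o) + ∑ e, Ψ o e))).rank ≤ ρ)
    (a : ∀ o, E o → ℂ) (R : O → Matrix σ σ ℂ) (r : O → ℕ) (hR : ∀ o, (R o).rank ≤ r o)
    (f : MvPolynomial σ ℂ)
    (hdec : hess0 (transl z f) = ∑ o, (∑ e, a o e • hess0 (transl z (Ψ o e)) + R o)) :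
    (hess0 (transl z f)).rank ≤ ∑ o, (Fintype.card (E o) * ρ + r o) := by
  rw [hdec]
  refine (rank_finset_sum_le _ _).trans (Finset.sum_le_sum fun o _ => ?_)
  refine (rank_add_le_rank_add _ _).trans ?_
  have h1 := rank_sum_smul_hess0_le_of_rayZeros (c o) (Ψ o) (d o) (hΨ o) (hd2 o) (hd o) z (t o) (ht o)
    (hg o) ρ (hnodes o) (a o)
  have h2 := hR o
  omega

/-- ★ **Assembly of the factor programme (counting form): `n³ ≤ m·(ρ+1)`.**  If moreover `rank Hess f(z) = n²`
(e.g. `f = per_n` at a Mignon–Ressayre point), the Gram remainders have rank `r_o ≤ #E_o`, and the degree budget of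
the shadow gives `n·Σ_o #E_o ≤ m`, then `n³ ≤ m·(ρ + 1)` — with `ρ = 2m + 2` the 3/2 rung `n³ ≤ m(2m+3)`. [folklore] -/
theorem cube_le_of_factorData {O : Type*} [Fintype O] (E : O → Type*) [∀ o, Fintype (E o)]
    [∀ o, DecidableEq (E o)] (c : O → ℂ) (Ψ : ∀ o, E o → MvPolynomial σ ℂ) (d : ∀ o, E o → ℕ)
    (hΨ : ∀ o e, (Ψ o e).IsHomogeneous (d o e)) (hd2 : ∀ o e, 2 ≤ d o e)
    (hd : ∀ o, Function.Injective (d o)) (z : σ → ℂ) (g : O → ℕ) (t : ∀ o, Fin (g o) → ℂ)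
    (ht : ∀ o, Function.Injective (t o)) (hg : ∀ o e, d o e - 2 < g o) (ρ : ℕ)
    (hnodes : ∀ o i, (hess0 (transl (t o i • z) (MvPolynomial.C (c o) + ∑ e, Ψ o e))).rank ≤ ρ)
    (a : ∀ o, E o → ℂ) (R : O → Matrix σ σ ℂ) (hR : ∀ o, (R o).rank ≤ Fintype.card (E o))
    (f : MvPolynomial σ ℂ)
    (hdec : hess0 (transl z f) = ∑ o, (∑ e, a o e • hess0 (transl z (Ψ o e)) + R o))
    {n m : ℕ} (hfull : (hess0 (transl z f)).rank = n ^ 2)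
    (hbudget : n * ∑ o, Fintype.card (E o) ≤ m) :
    n ^ 3 ≤ m * (ρ + 1) := by
  have h := rank_hess0_le_of_factorData E c Ψ d hΨ hd2 hd z g t ht hg ρ hnodes a R
    (fun o => Fintype.card (E o)) hR f hdec
  rw [hfull] at h
  have hsum : ∑ o, (Fintype.card (E o) * ρ + Fintype.card (E o)) = (ρ + 1) * ∑ o, Fintype.card (E o) := by
    rw [Finset.mul_sum]
    exact Finset.sum_congr rfl fun o _ => by ring
  rw [hsum] at h
  calc n ^ 3 = n * n ^ 2 := by ring
    _ ≤ n * ((ρ + 1) * ∑ o, Fintype.card (E o)) := Nat.mul_le_mul_left _ h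
    _ = (ρ + 1) * (n * ∑ o, Fintype.card (E o)) := by ring
    _ ≤ (ρ + 1) * m := Nat.mul_le_mul_left _ hbudget
    _ = m * (ρ + 1) := by ring

/-- **Numerical corollary: `ρ = 2m + 2` gives `n³ ≤ m(2m + 3)`.** [folklore] -/
theorem cube_le_of_factorData_mr {O : Type*} [Fintype O] (E : O → Type*) [∀ o, Fintype (E o)]
    [∀ o, DecidableEq (E o)] (c : O → ℂ) (Ψ : ∀ o, E o → MvPolynomial σ ℂ) (d : ∀ o, E o → ℕ)
    (hΨ : ∀ o e, (Ψ o e).IsHomogeneous (d o e)) (hd2 : ∀ o e, 2 ≤ d o e)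
    (hd : ∀ o, Function.Injective (d o)) (z : σ → ℂ) (g : O → ℕ) (t : ∀ o, Fin (g o) → ℂ)
    (ht : ∀ o, Function.Injective (t o)) (hg : ∀ o e, d o e - 2 < g o) {m : ℕ}
    (hnodes : ∀ o i, (hess0 (transl (t o i • z) (MvPolynomial.C (c o) + ∑ e, Ψ o e))).rank ≤ 2 * m + 2)
    (a : ∀ o, E o → ℂ) (R : O → Matrix σ σ ℂ) (hR : ∀ o, (R o).rank ≤ Fintype.card (E o))
    (f : MvPolynomial σ ℂ)
    (hdec : hess0 (transl z f) = ∑ o, (∑ e, a o e • hess0 (transl z (Ψ o e)) + R o))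
    {n : ℕ} (hfull : (hess0 (transl z f)).rank = n ^ 2)
    (hbudget : n * ∑ o, Fintype.card (E o) ≤ m) :
    n ^ 3 ≤ m * (2 * m + 3) :=
  cube_le_of_factorData E c Ψ d hΨ hd2 hd z g t ht hg (2 * m + 2) hnodes a R hR f hdec hfull hbudget

end Summit.ValiantsHypothesis.ValiantsHypothesis.Theorems.GrenetZeonTwoDimCoefficients.ScalingClosure

end
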